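import Summits.RiemannHypothesis.RiemannHypothesis.Theorems.TiltedLandingLaw421MonovariantSocketA

/-! # TiltedLandingLaw421MonovariantSocketB
c13 PREFIX socket §P (C4 rh-idea-6 g21): `Charged`, `MonovariantPrefixG/Prefix`, `prefix_of_monovariant`, `denseLevelCensusLow_of_prefix`, `descentSigS'_of_prefix`; §W (C1 g20): `zeroMeter`, `prefixG_zero_iff`, `monovariantPrefix_zero_iff` (gate K-c13-G5: the prefix socket at the zero meter IS β-low).
SUPPORT module for crux `TiltedLandingLaw421` (stmt-RiemannHypothesis-24774), `--supports` only: proves no stub, no crux; fully proved (no `sorry`).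
Packaged by C4 rh-idea-6 g21 per director (CA239)(1) in the (CA237) lint shape. RH is not proved. -/

namespace RhW07.C12.FieldSplit

open Complex
open RhIdea6.G17.W07C7 RhIdea6.G17.W07C7.Rev6 RhIdea6.G18.W07C8.Law421BirthS RhIdea6.G19.W07C11.Seam
open RhIdea6.G20.W07C12.Frac RhIdea6.G20.W07C12.StColP

/-- the CHARGE predicate of level `j` (= antecedent of (β1′) clause (iii)): some lowest tracked state is not ready and not `P`-certified. -/
def Charged (P St Ready : StatePred) (η : ℝ) (f : ℂ → ℂ) (x₀ s hmax R Hs : ℝ) (B : ℕ) (j : ℕ) : Prop :=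
  ∃ v : ℂ, IsLowest St η f x₀ s hmax R Hs B j v ∧ ¬ Ready η f x₀ s hmax R Hs B j v ∧ ¬ P η f x₀ s hmax R Hs B j v

open Classical in
/-- **(β1″) generic PREFIX socket** `MonovariantPrefixG μ cE P St Ready M`: lifts `lam ≥ 0`, meter `M ≥ 0`, successors inside the lift at every
charged level, and for EVERY `k` the charges already incurred below `k` plus the meter AT `k` fit in the purse `(Hs/s)² + B + cE`. -/
def MonovariantPrefixG (μ cE : ℝ) (P St Ready : StatePred) (M : LevelMeter) : Prop :=
  ∀ (η : ℝ) (f : ℂ → ℂ) (x₀ s hmax R Hs : ℝ) (B : ℕ), EngineHyps5 2 η f x₀ s hmax R Hs B →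
    ∃ lam : ℕ → ℝ, (∀ j : ℕ, 0 ≤ lam j) ∧ (∀ j : ℕ, 0 ≤ M η f x₀ s hmax R Hs B j) ∧
      (∀ j : ℕ, Charged P St Ready η f x₀ s hmax R Hs B j →
        ∀ u : ℂ, St η f x₀ s hmax R Hs B j u → ¬ Ready η f x₀ s hmax R Hs B j u →
          ∃ u' : ℂ, St η f x₀ s hmax R Hs B (j + 1) u' ∧ |u'.im| ≤ |u.im| + lam j) ∧
      ∀ k : ℕ, (∑ j ∈ Finset.range k, (if Charged P St Ready η f x₀ s hmax R Hs B j then 1 + lam j / (μ * s) else 0))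
        + M η f x₀ s hmax R Hs B k ≤ (Hs / s) ^ 2 + B + cE

/-- (β1″) at the node's literals: μ = 1/4, cE = 1, `St = StCol'`, `Ready = CumReady WindowReady`. -/
def MonovariantPrefix (P : StatePred) (M : LevelMeter) : Prop :=
  MonovariantPrefixG (1 / 4) 1 P StCol' (CumReady WindowReady) M

open Classical in

/-- ★ **(K) (β2′) ∧ (β1′) ⇒ (β1″)**: C1's per-level socket implies the prefix socket (telescoping; the lifts are the per-level witnesses). -/
theorem prefix_of_monovariant {μ cE : ℝ} {P St Ready : StatePred} {M : LevelMeter}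
    (hI : MonovariantInitG cE M) (hS : MonovariantStepG μ P St Ready M) : MonovariantPrefixG μ cE P St Ready M := by
  intro η f x₀ s hmax R Hs B hE
  classical
  obtain ⟨hM0, hmono, hstep⟩ := hS η f x₀ s hmax R Hs B hE
  have hpurse := hI η f x₀ s hmax R Hs B hE
  -- the lift at a charged level is the (β1′) witness, else 0
  let lam : ℕ → ℝ := fun j =>
    if h : Charged P St Ready η f x₀ s hmax R Hs B j then Classical.choose (hstep j h) else 0
  have hspec : ∀ j (h : Charged P St Ready η f x₀ s hmax R Hs B j),
      0 ≤ lam j ∧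
      (∀ u : ℂ, St η f x₀ s hmax R Hs B j u → ¬ Ready η f x₀ s hmax R Hs B j u →
          ∃ u' : ℂ, St η f x₀ s hmax R Hs B (j + 1) u' ∧ |u'.im| ≤ |u.im| + lam j) ∧
      M η f x₀ s hmax R Hs B (j + 1) + 1 + lam j / (μ * s) ≤ M η f x₀ s hmax R Hs B j := by
    intro j h
    have hc := Classical.choose_spec (hstep j h)
    have hl : lam j = Classical.choose (hstep j h) := by simp only [lam, dif_pos h]
    rw [hl]; exact hc
  refine ⟨lam, ?_, hM0, ?_, ?_⟩
  · intro j
    by_cases h : Charged P St Ready η f x₀ s hmax R Hs B j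
    · exact (hspec j h).1
    · simp only [lam, dif_neg h]; exact le_refl 0
  · intro j hj u hu hnr
    exact (hspec j hj).2.1 u hu hnr
  · have key : ∀ k : ℕ, (∑ j ∈ Finset.range k,
        (if Charged P St Ready η f x₀ s hmax R Hs B j then 1 + lam j / (μ * s) else 0))
          + M η f x₀ s hmax R Hs B k ≤ M η f x₀ s hmax R Hs B 0 := by
      intro k
      induction k with
      | zero => simp
      | succ k ih =>
        rw [Finset.sum_range_succ]
        by_cases h : Charged P St Ready η f x₀ s hmax R Hs B k
        · rw [if_pos h]; have h3 := (hspec k h).2.2; linarith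
        · rw [if_neg h]; have h2 := hmono k; linarith
    intro k; exact (key k).trans hpurse

/-- ★★ **(K) (β1″) ⇒ (β-low)**: the prefix socket implies the priced stopped census.  The charged set `{j | Charged …}` is FINITE (every initial
count is ≤ purse, each charge costs ≥ 1) and serves as the census's `E`; budget at `k := max E + 1`. -/
theorem denseLevelCensusLow_of_prefix {μ cE : ℝ} (hμ : 0 < μ) {P St Ready : StatePred} {M : LevelMeter}
    (h : MonovariantPrefixG μ cE P St Ready M) : DenseLevelCensusLow μ cE P St Ready := by
  intro η f x₀ s hmax R Hs B hE
  classical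
  have hs : 0 < s := hE.2.2.2.1
  have hμs : 0 < μ * s := mul_pos hμ hs
  obtain ⟨lam, hlam0, hM0, hsucc, hpre⟩ := h η f x₀ s hmax R Hs B hE
  -- shorthand for the charge predicate of this datum
  set C : ℕ → Prop := Charged P St Ready η f x₀ s hmax R Hs B with hCdef
  -- (1) every filtered count is ≤ purse
  have hsum : ∀ k : ℕ, (∑ j ∈ (Finset.range k).filter C, (1 + lam j / (μ * s))) ≤ (Hs / s) ^ 2 + B + cE := by
    intro k
    have h1 := hpre k
    have h2 := hM0 k
    rw [Finset.sum_filter]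
    linarith
  have hcard : ∀ k : ℕ, (((Finset.range k).filter C).card : ℝ) ≤ (Hs / s) ^ 2 + B + cE := by
    intro k
    have h1 : (((Finset.range k).filter C).card : ℝ) = ∑ j ∈ (Finset.range k).filter C, (1 : ℝ) := by
      rw [Finset.sum_const, nsmul_eq_mul, mul_one]
    have h2 : (∑ j ∈ (Finset.range k).filter C, (1 : ℝ)) ≤ ∑ j ∈ (Finset.range k).filter C, (1 + lam j / (μ * s)) := by
      apply Finset.sum_le_sum
      intro j _
      have := div_nonneg (hlam0 j) hμs.le
      linarith
    rw [h1]; exact h2.trans (hsum k)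
  -- (2) hence the charged set is finite
  have hfin : Set.Finite {j : ℕ | C j} := by
    by_contra hinf
    obtain ⟨T, hTS, hTcard⟩ := Set.Infinite.exists_subset_card_eq hinf (⌈(Hs / s) ^ 2 + B + cE⌉₊ + 1)
    have hTsub : T ⊆ (Finset.range (T.sup id + 1)).filter C := by
      intro j hj
      rw [Finset.mem_filter, Finset.mem_range]
      refine ⟨Nat.lt_succ_of_le ?_, hTS (by simpa using hj)⟩
      exact Finset.le_sup (f := id) hj
    have h1 := Finset.card_le_card hTsub
    have h2 := hcard (T.sup id + 1)
    have h3 : ((⌈(Hs / s) ^ 2 + ↑B + cE⌉₊ + 1 : ℕ) : ℝ) ≤ (Hs / s) ^ 2 + B + cE := by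
      rw [← hTcard]; exact le_trans (by exact_mod_cast h1) h2
    have h4 := Nat.le_ceil ((Hs / s) ^ 2 + ↑B + cE)
    push_cast at h3
    linarith
  -- (3) E := the charged set
  have hmem : ∀ j : ℕ, j ∈ hfin.toFinset ↔ C j := by
    intro j; rw [Set.Finite.mem_toFinset]; rfl
  refine ⟨hfin.toFinset, lam, hlam0, ?_, ?_, ?_⟩
  · -- budget at k := sup E + 1
    have hEq : (Finset.range (hfin.toFinset.sup id + 1)).filter C = hfin.toFinset := by
      ext j
      rw [Finset.mem_filter, Finset.mem_range, hmem]
      constructor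
      · rintro ⟨-, hj⟩; exact hj
      · intro hj
        refine ⟨Nat.lt_succ_of_le ?_, hj⟩
        exact Finset.le_sup (f := id) ((hmem j).2 hj)
    have h1 : (∑ j ∈ hfin.toFinset, (1 + lam j / (μ * s)))
        = (hfin.toFinset.card : ℝ) + (∑ j ∈ hfin.toFinset, lam j) / (μ * s) := by
      rw [Finset.sum_add_distrib, Finset.sum_const, nsmul_eq_mul, mul_one, Finset.sum_div]
    have h2 := hsum (hfin.toFinset.sup id + 1)
    rw [hEq, h1] at h2
    exact h2
  · -- off E: the lowest not-ready state is P-certified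
    intro j v hjE hlow hnr
    by_contra hP
    exact hjE ((hmem j).2 ⟨v, hlow, hnr, hP⟩)
  · -- on E: successors inside the lift
    intro j u hjE hu hnr
    exact hsucc j ((hmem j).1 hjE) u hu hnr

/-- ★ (K) (β1″) ⇒ (β-low) at the literals. -/
theorem denseLevelCensusStopLow_of_prefix {P : StatePred} {M : LevelMeter} (h : MonovariantPrefix P M) :
    DenseLevelCensusStopLow P :=
  denseLevelCensusLow_of_prefix (by norm_num) h

/-- ★ (K) (β2′) ∧ (β1′) ⇒ (β1″) at the literals (C1's socket feeds the prefix socket). -/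
theorem prefix_of_monovariantStep {P : StatePred} {M : LevelMeter} (hI : MonovariantInit M) (hS : MonovariantStep P M) :
    MonovariantPrefix P M :=
  prefix_of_monovariant hI hS

/-- ★★ (K) the cycle-13 chain in prefix form: (α-low) ∧ (β1″) ⇒ `DescentSigS'` (through the registered node's `descentSigS'_of_fieldSplitLowLow`). -/
theorem descentSigS'_of_prefix {P : StatePred} {M : LevelMeter}
    (hα : IsolatedPairDropLow P) (hP : MonovariantPrefix P M) : DescentSigS' :=
  descentSigS'_of_fieldSplitLowLow hα (denseLevelCensusStopLow_of_prefix hP)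

/-- (K) and nothing is lost: (β-low) at any dial comes from SOME meter in prefix form. -/
theorem prefix_of_denseLevelCensusStopLow {P : StatePred} (h : DenseLevelCensusStopLow P) :
    ∃ M : LevelMeter, MonovariantPrefix P M := by
  obtain ⟨M, hI, hS⟩ := monovariant_of_denseLevelCensusStopLow h
  exact ⟨M, prefix_of_monovariantStep hI hS⟩

end RhW07.C12.FieldSplit

namespace RhW07.C12.FieldSplit

open Complex
open RhIdea6.G17.W07C7 RhIdea6.G17.W07C7.Rev6 RhIdea6.G18.W07C8.Law421BirthS RhIdea6.G19.W07C11.Seam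
open RhIdea6.G20.W07C12.Frac RhIdea6.G20.W07C12.StColP

/-- the ZERO meter `M ≡ 0`. -/
def zeroMeter : LevelMeter := fun _ _ _ _ _ _ _ _ _ => 0

/-- `zeroMeter` evaluates to 0 at any level. -/
@[simp] theorem zeroMeter_apply (η : ℝ) (f : ℂ → ℂ) (x₀ s hmax R Hs : ℝ) (B j : ℕ) :
    zeroMeter η f x₀ s hmax R Hs B j = 0 := rfl

/-- (W1) meter monotonicity of the prefix socket: a pointwise-smaller nonnegative meter inherits it (same lifts). -/
theorem prefixG_meter_mono {μ cE : ℝ} {P St Ready : StatePred} {M M' : LevelMeter}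
    (hle : ∀ (η : ℝ) (f : ℂ → ℂ) (x₀ s hmax R Hs : ℝ) (B : ℕ), EngineHyps5 2 η f x₀ s hmax R Hs B →
      ∀ j : ℕ, 0 ≤ M' η f x₀ s hmax R Hs B j ∧ M' η f x₀ s hmax R Hs B j ≤ M η f x₀ s hmax R Hs B j)
    (h : MonovariantPrefixG μ cE P St Ready M) : MonovariantPrefixG μ cE P St Ready M' := by
  intro η f x₀ s hmax R Hs B hE
  classical
  obtain ⟨lam, hlam0, hM0, hsucc, hpre⟩ := h η f x₀ s hmax R Hs B hE
  have hle' := hle η f x₀ s hmax R Hs B hE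
  refine ⟨lam, hlam0, fun j => (hle' j).1, hsucc, fun k => ?_⟩
  have h1 := hpre k
  have h2 := (hle' k).2
  linarith

/-- (W2) the meter can always be DROPPED: any prefix-form seal implies the prefix socket at the zero meter. -/
theorem prefixG_zero_of_prefixG {μ cE : ℝ} {P St Ready : StatePred} {M : LevelMeter}
    (h : MonovariantPrefixG μ cE P St Ready M) : MonovariantPrefixG μ cE P St Ready zeroMeter := by
  refine prefixG_meter_mono (fun η f x₀ s hmax R Hs B hE j => ⟨(zeroMeter_apply η f x₀ s hmax R Hs B j).ge, ?_⟩) h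
  obtain ⟨lam, -, hM0, -, -⟩ := h η f x₀ s hmax R Hs B hE
  exact (zeroMeter_apply η f x₀ s hmax R Hs B j).trans_le (hM0 j)

/-- (W3) **(β-low) ⇒ the prefix socket at the zero meter** (`E ⊇` charged levels; prefix sums ≤ `#E + Σλ/(μ s)` ≤ purse; only `0 ≤ μ` is used). -/
theorem prefixG_zero_of_denseLevelCensusLow {μ cE : ℝ} (hμ : 0 ≤ μ) {P St Ready : StatePred}
    (h : DenseLevelCensusLow μ cE P St Ready) : MonovariantPrefixG μ cE P St Ready zeroMeter := by
  intro η f x₀ s hmax R Hs B hE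
  classical
  have hs : 0 < s := hE.2.2.2.1
  have hμs : 0 ≤ μ * s := mul_nonneg hμ hs.le
  obtain ⟨E, lam, hlam0, hbud, hoff, hon⟩ := h η f x₀ s hmax R Hs B hE
  set C : ℕ → Prop := Charged P St Ready η f x₀ s hmax R Hs B with hCdef
  -- every charged level lies in `E` (off `E` the lowest not-ready state is `P`-certified)
  have hCE : ∀ j : ℕ, C j → j ∈ E := by
    intro j hj
    by_contra hjE
    obtain ⟨v, hlow, hnr, hP⟩ := hj
    exact hP (hoff j v hjE hlow hnr)
  refine ⟨lam, hlam0, fun j => (zeroMeter_apply η f x₀ s hmax R Hs B j).ge, ?_, ?_⟩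
  · intro j hj u hu hnr
    exact hon j u (hCE j hj) hu hnr
  · intro k
    have hsub : (Finset.range k).filter C ⊆ E := by
      intro j hj
      rw [Finset.mem_filter] at hj
      exact hCE j hj.2
    have hnn : ∀ j ∈ E, j ∉ (Finset.range k).filter C → 0 ≤ 1 + lam j / (μ * s) := by
      intro j _ _
      have := div_nonneg (hlam0 j) hμs
      linarith
    have h1 : (∑ j ∈ (Finset.range k).filter C, (1 + lam j / (μ * s))) ≤ ∑ j ∈ E, (1 + lam j / (μ * s)) :=
      Finset.sum_le_sum_of_subset_of_nonneg hsub hnn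
    have h2 : (∑ j ∈ E, (1 + lam j / (μ * s))) = (E.card : ℝ) + (∑ j ∈ E, lam j) / (μ * s) := by
      rw [Finset.sum_add_distrib, Finset.sum_const, nsmul_eq_mul, mul_one, Finset.sum_div]
    have h3 : (∑ j ∈ Finset.range k, (if C j then 1 + lam j / (μ * s) else 0))
        = ∑ j ∈ (Finset.range k).filter C, (1 + lam j / (μ * s)) := by
      rw [Finset.sum_filter]
    rw [zeroMeter_apply, add_zero, h3]
    linarith

/-- ★★ (W4) **WORDS-1**: at the zero meter the prefix socket IS the priced stopped census (β-low). -/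
theorem prefixG_zero_iff {μ cE : ℝ} (hμ : 0 < μ) {P St Ready : StatePred} :
    MonovariantPrefixG μ cE P St Ready zeroMeter ↔ DenseLevelCensusLow μ cE P St Ready :=
  ⟨denseLevelCensusLow_of_prefix hμ, prefixG_zero_of_denseLevelCensusLow hμ.le⟩

/-- ★★ (W4) at the literals: `MonovariantPrefix P zeroMeter ↔ DenseLevelCensusStopLow P` — a sealed meter adds the RESERVE obligation, nothing else. -/
theorem monovariantPrefix_zero_iff {P : StatePred} : MonovariantPrefix P zeroMeter ↔ DenseLevelCensusStopLow P :=
  prefixG_zero_iff (by norm_num)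

/-- (W5) every prefix-form seal factors through (β-low): `MonovariantPrefix P M → MonovariantPrefix P zeroMeter` (= (β-low) by (W4)). -/
theorem monovariantPrefix_zero_of_monovariantPrefix {P : StatePred} {M : LevelMeter} (h : MonovariantPrefix P M) :
    MonovariantPrefix P zeroMeter :=
  prefixG_zero_of_prefixG h

/-- (W6) CONTRAST: C1's PER-LEVEL socket at the zero meter says NO level is ever charged (unpriced c12 reading, `E = ∅`). -/
theorem monovariantStepG_zero_iff {μ : ℝ} (hμ : 0 < μ) {P St Ready : StatePred} :
    MonovariantStepG μ P St Ready zeroMeter ↔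
    ∀ (η : ℝ) (f : ℂ → ℂ) (x₀ s hmax R Hs : ℝ) (B : ℕ), EngineHyps5 2 η f x₀ s hmax R Hs B →
      ∀ j : ℕ, ¬ Charged P St Ready η f x₀ s hmax R Hs B j := by
  constructor
  · intro h η f x₀ s hmax R Hs B hE j hC
    have hs : 0 < s := hE.2.2.2.1
    obtain ⟨-, -, hstep⟩ := h η f x₀ s hmax R Hs B hE
    obtain ⟨lam, hlam0, -, hle⟩ := hstep j hC
    have h1 : 0 ≤ lam / (μ * s) := div_nonneg hlam0 (mul_pos hμ hs).le
    rw [zeroMeter_apply, zeroMeter_apply] at hle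
    linarith
  · intro h η f x₀ s hmax R Hs B hE
    refine ⟨fun j => (zeroMeter_apply η f x₀ s hmax R Hs B j).ge, fun j => ?_, fun j hC => ?_⟩
    · rw [zeroMeter_apply, zeroMeter_apply]
    · exact absurd hC (h η f x₀ s hmax R Hs B hE j)

/-- (W6) at the literals. -/
theorem monovariantStep_zero_iff {P : StatePred} :
    MonovariantStep P zeroMeter ↔
    ∀ (η : ℝ) (f : ℂ → ℂ) (x₀ s hmax R Hs : ℝ) (B : ℕ), EngineHyps5 2 η f x₀ s hmax R Hs B →
      ∀ j : ℕ, ¬ Charged P StCol' (CumReady WindowReady) η f x₀ s hmax R Hs B j :=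
  monovariantStepG_zero_iff (by norm_num)

end RhW07.C12.FieldSplit
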